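import Summits.CriticalPhenomena.PercolationContinuityZ3.Theorems.Transplant.PlanarSkeletonFrmQuasiDefs
import Summits.CriticalPhenomena.PercolationContinuityZ3.Theorems.Transplant.SkelFrmQuasiBParamsCorrKG0
import Summits.CriticalPhenomena.PercolationContinuityZ3.Theorems.Transplant.SkelFrmBParamsCorrKG0
import Summits.CriticalPhenomena.PercolationContinuityZ3.Theorems.Transplant.SkelFrmQuasi1ParamsLBL
import Summits.CriticalPhenomena.PercolationContinuityZ3.Theorems.Transplant.SkelFrmQuasi1ParamsPO
import Summits.CriticalPhenomena.PercolationContinuityZ3.Theorems.Transplant.SkelFrmQuasiBChoiceNums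
import Summits.CriticalPhenomena.PercolationContinuityZ3.Theorems.Transplant.SkelFrmQuasiBParamsCorrKG
import Summits.CriticalPhenomena.PercolationContinuityZ3.Theorems.Transplant.SkelFrmQuasiBParamsLF
import HarnessLib
import Summits.CriticalPhenomena.PercolationContinuityZ3.Theorems.Transplant.SkelFrmBParamsCorrKGLen
/-!
# GEN-Q PORT (WAVE-Q table v0.8 section 2, row G040, U-level L8; captain R-6/R-7 2026-08-27: carrier token swap `PlanarSkeletonFrmFrom ↦ PlanarSkeletonFrmQuasi`)
# of the tree module «Transplant/SkelFrmFromBParamsCorrKGLen» (sha256 72e0caf72b395ca5…) onto the quasi-step carrier `PlanarSkeletonFrmQuasi` (p507026): «SkelFrmQuasiBParamsCorrKGLen»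

HAND HUNK (L-FLOORMAP-1 ①, reader of G017 «SkelFrmQuasiBChoiceNums» through G023's `kgR/gFloorKG`): `KS0.R'0 κ Φ … ↦ KS0.R'0N κ Φ (KS.NQ Φ) …` at the 1 unfolded site(s) in the proofs.

ORIGINAL TITLE: N2 (frames-only node `SamePDropOfSkeletonFrmFrom₁`, OPEN) — (ζ″) ledger, THE K-G CORRIDOR'S LENGTH BUDGET: closed bounds on p5-g16's step counts

builds on p205010 (kernel theorem, internal audit signed; external expert review pending) — nothing in this file uses p205010; NOTHING is claimed about any open node
((N3-b), the end state).  Lane `prim-bschramm`, seat `prim-bschramm-stmt` (gen 33; GEN-Q column pen; tool = captain gen-1 g4's port_genq.py R-14 --cone + p3-g30's T1 patch).  Helper file (`--supports stmt-CriticalPhenomena-4575 --as helper`).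
PORT RULES (U-wave r1–r4 re-used, GEN-Q hunk classes of p3-g29 #6136): declaration order, names and proof texts are those of «SkelFrmFromBParamsCorrKGLen», byte-identical except
(i) the carrier token `PlanarSkeletonFrmFrom ↦ PlanarSkeletonFrmQuasi` in binders, `namespace`/`end` lines and qualified names (module names `SkelFrmFrom… ↦ SkelFrmQuasi…`
in imports of already-ported rows); (ii) `Φ.step ↦ Φ.qstep` with the called Steps lemma replaced by its `…Q`/`_q` twin and the cost `Φ.M` threaded (none in this file unless
listed below); (iii) `Φ.cyl_connected ↦ Φ.cyl_reach` readers (none unless listed); (iv) graph-ball radii / window floors ×`Φ.M` (none unless listed).  Carrier-free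
residents stay imported/exported from the original «SkelFrmBParamsCorrKGLen» exactly as in the FrmFrom port.  Docstrings and citations are the original's.

-/

open scoped Classical

noncomputable section

namespace Summit.CriticalPhenomena.PercolationContinuityZ3.Theorems.Transplant

namespace Skelφ

/-! ## §1 Generic budgets over `KGRows` -/

section Budget

variable {n ℓ : ℕ} {hs v : ℤ} {R' ρ q W : ℕ}

end Budget

end Skelφ

/-! ## §2 At the values of record (`ρ := 0`, SkelFrmBParamsCorrKG0): `h0` and the (R-34) length budget `LfQ` -/

namespace PlanarSkeletonFrmQuasi

namespace NegB

open Literature.Probability.Percolation Literature.Probability.LatticeModels SimpleGraph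
open SkelConc (Consts)
open Skelφ (shearUnit kgSL kgΔ kgN kgFar kgX₂ kgM₁ kgM₂ KGRows)
open Neg

section Values

variable (κ : Consts) {V : Type} [DecidableEq V] [Countable V] {G : SimpleGraph V} [G.LocallyFinite] (Φ : PlanarSkeletonFrmQuasi G) (t : V) (p : unitInterval)
  (D : Skelφ.StepI.DataNS V) (g f mk qx Wx : ℕ)

/-- **The residual floors** of the corridor tuple: `qx ≤ 40·n_L` and `Wx ≤ 20·sL` (room for the start-box rows `haq/hbW`). [this work] -/
structure KGRes : Prop where
  /-- `qx ≤ 40·n_L` -/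
  hqx : qx ≤ 40 * nL κ Φ t p D g f
  /-- `Wx ≤ 20·sL` -/
  hWx : (Wx : ℤ) ≤ 20 * kgSL (nL κ Φ t p D g f) (ℓL κ Φ t p D g f) (hL κ Φ t p D g f)

/-- The generic floors at the values (`ρ := 0`): `3(2R′+0) ≤ sL`, `3(2R′+0) ≤ n_L`, `4R′+3·0 ≤ n_L`, `8R′ ≤ sL`, and `W ≤ 21·sL` under `Wx ≤ 20·sL`. [folklore] -/
theorem kg_floors (κ : Consts) {V : Type} [DecidableEq V] [Countable V] {G : SimpleGraph V} [G.LocallyFinite] (Φ : PlanarSkeletonFrmQuasi G) (t : V) (p : unitInterval) (D : Skelφ.StepI.DataNS V) (g : ℕ) (f : ℕ) (mk : ℕ) (Wx : ℕ) (hN : EqNumL κ Φ t p D g f) (hg : gFloorKG κ Φ t p D mk ≤ g)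
    (hWx : (Wx : ℤ) ≤ 20 * kgSL (nL κ Φ t p D g f) (ℓL κ Φ t p D g f) (hL κ Φ t p D g f)) :
    3 * (2 * ((kgR κ Φ t p D mk : ℕ) : ℤ) + ((0 : ℕ) : ℤ)) ≤ kgSL (nL κ Φ t p D g f) (ℓL κ Φ t p D g f) (hL κ Φ t p D g f) ∧
    3 * (2 * ((kgR κ Φ t p D mk : ℕ) : ℤ) + ((0 : ℕ) : ℤ)) ≤ (nL κ Φ t p D g f : ℤ) ∧
    4 * ((kgR κ Φ t p D mk : ℕ) : ℤ) + 3 * ((0 : ℕ) : ℤ) ≤ (nL κ Φ t p D g f : ℤ) ∧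
    8 * ((kgR κ Φ t p D mk : ℕ) : ℤ) ≤ kgSL (nL κ Φ t p D g f) (ℓL κ Φ t p D g f) (hL κ Φ t p D g f) ∧
    ((kgW κ Φ t p D g f Wx : ℕ) : ℤ) ≤ 21 * kgSL (nL κ Φ t p D g f) (ℓL κ Φ t p D g f) (hL κ Φ t p D g f) := by
  have hnle := hN.n_le
  have hgML : g ≤ ML κ Φ t p D g := (ML_le_ML κ Φ t p D g).2
  have hsL := ML_sub_one_le_kgSL κ Φ t p D g f hN
  unfold gFloorKG at hg
  have hfl : ((8 * KS0.R'0N κ Φ (KS.NQ Φ) t p D mk + 3 * Mu D + 6 : ℕ) : ℤ) ≤ ML κ Φ t p D g := by exact_mod_cast hg.trans hgML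
  push_cast at hfl
  unfold kgR kgW
  have hs0 : 0 ≤ kgSL (nL κ Φ t p D g f) (ℓL κ Φ t p D g f) (hL κ Φ t p D g f) := by linarith
  have ht : (((kgSL (nL κ Φ t p D g f) (ℓL κ Φ t p D g f) (hL κ Φ t p D g f)).toNat : ℕ) : ℤ) =
      kgSL (nL κ Φ t p D g f) (ℓL κ Φ t p D g f) (hL κ Φ t p D g f) := Int.toNat_of_nonneg hs0
  have hM0 : (0 : ℤ) ≤ (Mu D : ℤ) := by positivity
  push_cast
  rw [ht]
  refine ⟨by linarith, by linarith, by linarith, by linarith, by linarith⟩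

-- GEN-Q (R-2, captain 2026-08-27): `PlanarSkeletonFrmFrom.NegB.kgFar_zero_le_kgTgt0` is not in the used cone of the node top — not ported.

export PlanarSkeletonFrm.NegB (LfQ)

export PlanarSkeletonFrm.NegB (LfQ_eq)

-- GEN-Q (R-2, captain 2026-08-27): `PlanarSkeletonFrmFrom.NegB.kgSchedN_le_LfQ` is not in the used cone of the node top — not ported.

end Values

end NegB

end PlanarSkeletonFrmQuasi

end Summit.CriticalPhenomena.PercolationContinuityZ3.Theorems.Transplant

end
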